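import Mathlib
import HarnessLib
import Summits.HubbardSuperconductivity.HubbardSuperconductivity.Theorems.ComplexGFFStiffnessHolomorphicPackageLines
import Literature.MathematicalPhysics.StatisticalMechanics.AbkmPackageLocalSlots

/-!
# Crux child `TwoKernelSkBound` (stmt-…-27414), line `banach_two_kernel` — stub 1 RESHAPED one level lower:
# the local two-kernel bound for the RAW step map `nextKStep` implies the local slot for `S_k = Q.opS`

Route `route-HubbardSuperconductivity-ComplexGFFStiffness`, cruxes stmt-HubbardSuperconductivity-19154 (`HypACumulant`) /
stmt-…-19155 (`HypALocalTwoPoint`), child stmt-…-27414.  The registered stub 1 of the skeleton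
`Cruxes/HypACumulant/Lines/banach_two_kernel.lean` (`TwoKernelSkBoundLoc 4`: the LOCAL `N`-free two-kernel
comparison of `S_k^{(q)} = Q.opS q k`) is the admissible-activity wrapper of a statement about the RAW renormalisation
map of [ABKM19] Definition 6.5 (6.34): on the Theorem-6.8 ball `Q.opS q k u v` IS
`restrictConn (nextKStep (abkmStepData L R k 𝒞_{1+q,·}) (toHam u) (mulExt v))` (`packageAt_coe_opS`), and the weak norm
only reads connected polymers (`weakNormLE_restrictConn_iff`).  Hence the kernel-level bundle
`GradientRG.TwoKernelNextKStepLoc d` (`AbkmPackageLocalSlots`, appendix) — what the two-kernel twins of the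
Theorem-6.8 contraction files produce (linear part landed for every package: `PackageData.exists_weakNormLE_opC_sub`,
p827392) — implies the registered stub:

* `twoKernelSkBoundLoc_of_raw : TwoKernelNextKStepLoc d → TwoKernelSkBoundLoc d` (every `d`);
* `stub_twoKernelSkBoundLoc_of_raw` — the `d = 4` instance, a registered stub of the reshaped skeleton BY NAME.

All proved, no `sorry`; the kernel-level bundle enters as an explicit hypothesis (nothing is assumed as a named
fact).  Honest scope: plumbing on a rung route (stiffness of a complex Gaussian gradient field via the [ABKM19] RG);
the analytic core (the remainder twins) is NOT touched here; nothing about superconductivity in the Hubbard model.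

## References
* S. Adams, S. Buchholz, R. Kotecký, S. Müller, arXiv:1910.13564, Definition 6.5 (6.34), Theorem 6.8,
  Lemma 12.6 (12.53) [AdamsBuchholzKoteckyMuller2019].
-/

noncomputable section

-- `Summit.<Summit>.<Problem>`: single-conjunct summit, the duplicate component is mandated (D-0017).
set_option linter.dupNamespace false

namespace Summit.HubbardSuperconductivity.HubbardSuperconductivity.Theorems.ComplexGFF

open scoped BigOperators
open Literature.MathematicalPhysics.StatisticalMechanics.GradientRG
open Literature.MathematicalPhysics.StatisticalMechanics

variable {d : ℕ}

/-- **The raw-level local two-kernel bound implies the `opS`-level one** (same size `l_N`, same threshold `T₁`):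
`Q.opS q k u v − Q.opS q' k u v = restrictConn (K_{k+1}^{(q)} − K_{k+1}^{(q')})` on the Theorem-6.8 ball, and the weak
norm of scale `k + 1` is blind to `restrictConn`. -/
theorem twoKernelSkBoundLoc_of_raw (h : TwoKernelNextKStepLoc d) : TwoKernelSkBoundLoc d := by
  intro P _ _
  obtain ⟨lN, T₁, hlN, hT₁, hF⟩ := h P
  refine ⟨lN, T₁, hlN, hT₁, fun N M _ Q => ?_⟩
  intro q q' hq hq' ht k hk u v cv hu hv hcv
  have hW := hF N M Q q q' hq hq' ht k hk u v cv hu hv hcv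
  have hW' : WeakNormLE Q.normParams (k + 1)
      (nextKStep (abkmStepData P.L P.R k (Q.kernels q)) (HamSpace.toHam u)
          (mulExt ((v : activitySpace Q.normParams k) : Finset (Fin d → ZMod M) → ((Fin d → ZMod M) → ℝ) → ℂ)) -
        nextKStep (abkmStepData P.L P.R k (Q.kernels q')) (HamSpace.toHam u)
          (mulExt ((v : activitySpace Q.normParams k) : Finset (Fin d → ZMod M) → ((Fin d → ZMod M) → ℝ) → ℂ)))
      (lN * esum (q - q') * max ‖u‖ cv) := hW
  show WeakNormLE Q.normParams (k + 1)
    (((Q.opS q k u v - Q.opS q' k u v : activitySpace Q.normParams (k + 1)) :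
      Finset (Fin d → ZMod M) → ((Fin d → ZMod M) → ℝ) → ℂ)) (lN * esum (q - q') * max ‖u‖ cv)
  rw [Submodule.coe_sub, packageAt_coe_opS P Q hq hk u v hu hv hcv, packageAt_coe_opS P Q hq' hk u v hu hv hcv,
    ← restrictConn_sub]
  exact (weakNormLE_restrictConn_iff (P := Q.normParams) (k := k + 1)).2 hW'

/-- **Stub 1b of the reshaped skeleton `banach_two_kernel` — `stub_twoKernelSkBoundLoc_of_raw`** (registered on
stmt-HubbardSuperconductivity-27414): `TwoKernelNextKStepLoc 4 → TwoKernelSkBoundLoc 4`. -/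
theorem stub_twoKernelSkBoundLoc_of_raw : TwoKernelNextKStepLoc 4 → TwoKernelSkBoundLoc 4 :=
  fun h => twoKernelSkBoundLoc_of_raw h

end Summit.HubbardSuperconductivity.HubbardSuperconductivity.Theorems.ComplexGFF

end
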